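import Literature.MathematicalPhysics.QuantumFieldTheory.Balaban1983to89.B9Thm39WholeBlkFaces

/-!
# `Balaban1983to89.B9Thm39WholeBlkVia` — [B9] Theorem 3.9 ⇒ Theorem 3.2 (rows 15–16 of the N06 knit) with the carrier-kernel reading taken
# THROUGH A REPRESENTATIVE MAP `π : 𝔅 → 𝔅` of the geometry's sites (the shape the record's «sites = index bonds» reading can meet)

T. Bałaban, *Propagators for lattice gauge theories in a background field*, Commun. Math. Phys. **99** (1985) 389–434
[`Balaban1985BackgroundPropagators`, "B9"]; [4] = T. Bałaban, *Propagators and renormalization transformations for lattice gauge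
theories. II*, Commun. Math. Phys. **96** (1984) 223–250 [`Balaban1984PropagatorsII`].

statement-level skeleton of published theorems with citation tags; proofs where landed; nothing here is a claim about the
Yang–Mills mass gap

THE PRINTED LOCI (verbatim).  [B9] p. 413, Theorem 3.9: *"For M sufficiently large, and a configuration U satisfying (3.35), the operator
Q′G′²Q′\* has an inverse which can be represented as (Q′G′²Q′\*)⁻¹ = Σ_ω R′₀(X₀)R′_{α₁}(X₁)·⋯·R′_{αₙ}(Xₙ) (3.98) … This theorem implies
Theorem 3.2."*;  p. 398, Theorem 3.2: *"|(Q′(U)G′²(U)Q′\*(U))⁻¹(y, y′)| ≦ B₀(L^jη)^{−4}(L^{j′}η)^{−d}e^{−δ₀d(y,y′)}, y, y′ ∈ 𝔅 (y ∈ Λ_j,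
y′ ∈ Λ_{j′}) (3.48)"*;  [4] p. 248: *"We consider these operators on the L²-space defined by (2.69) with sites replaced by bonds"*;
[4] p. 231: *"d(x, x′) = d(y, y′) if x ∈ B^j(y), x′ ∈ B^{j′}(y′)"*;  [4] p. 232, (2.51): *"|(Tλ)(x)| ≦ K(y, y′)|λ|, x ∈ B^j(y), supp λ ⊂ B^{j′}(y′)"*.

WHY THIS FILE (successor of the seat's `B9Thm39WholeBlk` ∕ `B9Thm39WholeBlkFaces`, rows 15–16 over an abstract carrier `X` with block map
`blk : X → g.Site`).  The landed reading `B9Thm39WholeBlk.KerReadsLe 𝔬 Cv d cR` bounds the carrier kernel `|Cv.ker U y y′|` by the block norm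
`blockKer 𝔬.blk T y y′` of the inverse T of L(U), evaluated AT THE GEOMETRY'S SITES `y, y′ : g.Site`.  In the cell's geometry of record
(`Node00.CarriersB6K.kGeoU`, `B9GeoNormsKLevelV1.geo9K`) the sites ARE the index bonds of [4] (2.3) ([4] p. 248: *"sites replaced by bonds"*), every
block-indexed statement of [B9] being READ AT THE CARRIER BLOCK `β c ∈ 𝔅` of the bond `c` (`B6Ineq2142KLevelV1.β`; the operator layer's
`Cinv.ker U c c′ = sup_{|E| ≤ 1} ‖(C(U)(δ_{β c′} ⊗ E))(β c)‖`), and `β` is MANY-TO-ONE (several bonds per base block).  `blockKer blk T y y′` is a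
supremum over the FIBRE `blk⁻¹(y)`: a carrier whose block map misses an index bond `y` forces `Cv.ker U y · = 0` there, and a carrier meeting every
bond cannot carry the genuine (Q′G′²Q′\*)(U) — an operator on 𝔤-valued functions on the BLOCKS — invertibly (its pull-back along `β` has the rank of
the block space).  So `KerReadsLe` as typed is met at the record only by padded letters.  THE REPAIR (this file): read the block norm THROUGH A
REPRESENTATIVE MAP `π : g.Site → g.Site` — `KerReadsLeVia 𝔬 Cv d cR π`: |Cv.ker U y y′| ≦ cR·(L^{j′}η)^{−d}·blockKer(T)(π y, π y′).  At the record
`π := rep ∘ β` picks ONE bond per carrier block (`β ∘ π = β`), the carrier is `𝔅_blocks × (real coordinates of 𝔤)` fibred over the representatives, L(U)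
is the genuine operator in coordinates, and the reading becomes a THEOREM (the sibling `B9Thm39ReadingAtLetters`).  Since the geometry's `dist` and
`len` FACTOR THROUGH `β` ([4] p. 231: *"d(x, x′) = d(y, y′) if x ∈ B^j(y) …"*; `kGeo.dist b b′ = d_T(β b, β b′)`, `kGeo.scale b = j(β b)`), they are
π-invariant, and the kernel-summation leaf (Theorem 3.9 ⇒ Theorem 3.2) goes through verbatim: the inverse's (2.51)-majorant at (π y, π y′) IS the
printed bound at (y, y′).  The Theorem-3.9 half (`B9.Thm39Printed` at the datum `EK39OfOpsBlk`) is UNCHANGED — (3.99) is an upper bound on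
`kterm`, and an empty fibre only makes `kterm` vanish.

* §1 `KerReadsLeVia 𝔬 Cv d cR π`; `kerReadsLeVia_id_iff` (π = id is `KerReadsLe`).
* §2 `rwKernelSumYields_of_conv348BlkVia` ∕ `rwKernelSumYields_EK39OfOpsBlkVia` ∕ `thm32Printed_EK39OfOpsBlkVia` — the kernel-summation leaf and
  Theorem 3.2 as typed, under `len (π y) = len y`, `dist (π y) (π y′) = dist y y′`.
* §3 rows 15 ∧ 16 at the DEFINITE (2.61) constant `rowConst261` ([4] Lemma 2.1 supplied by `RowSum261 geo`): `thm39_and_kernelSum_rowConst261BlkVia_of_rowSum261`,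
  the pin form `thm39_and_kernelSum_of_pin_rowConst261BlkVia`, `thm32Printed_of_pin_rowConst261BlkVia`.
* §4 ★ `t39_hksum_of_pin_rowConst261BlkVia` — rows 15 ∧ 16 over def-Y's operator-layer signature `ops : ∀ x, OperatorLayerY … x` from the literal
  carrier pin and `KerReadsLeVia … (π x)`; (2.61) at both rates is n06-i's `rowSum261_geo9Y` BY NAME.

HONEST SCOPE.  Kernel bookkeeping; every Theorem-3.9 schema (`StaticOK39Blk`, `Locality39Blk`, `Local348Blk`, `Identities395Blk`, `Small285Blk`,
`Factors389Blk`) stays a DISPLAYED hypothesis of printed shape and the reading `KerReadsLeVia` is a hypothesis HERE (discharged at def-Y's letters in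
the sibling); nothing of [B9] or [4] is asserted; the re-expansion of pp. 411–412 is not reproduced.  NOT a node discharge, NOT summit progress;
count-neutral; one finite 𝕋⁴ programme — nothing continuum, nothing about the mass gap.  Cell `pub-ymgap` (HUMAN RULING D-0062), Track A node
N06 [B9], seat `pub-ymgap-dag-n06-j` (harness re-seat gen 5), 2026-08-27.
-/

namespace Literature.MathematicalPhysics.QuantumFieldTheory.Balaban1983to89.B9Thm39WholeBlkVia

open Literature.MathematicalPhysics.QuantumFieldTheory.Balaban1983to89
open Finset B6RandomWalk B9Thm34Inv B9Thm39Whole B9Thm39WholeBlk B9Thm39WholeBlkFaces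

noncomputable section

/-! ## §1 The reading through a representative map -/

section OneMember

variable {g : B9.Geometry} [DecidableEq g.Site] {B : B9.Backgrounds} {X ι κ : Type} [Fintype X] [DecidableEq X]

/-- ★ **THE CARRIER KERNEL READS THE INVERSE THROUGH A REPRESENTATIVE MAP `π`**: at every U at which L(U) has a two-sided inverse T on `X → ℝ`,
|Cv(U)(y, y′)| ≦ cR·(L^{j′}η)^{−d}·(block norm of T at (π y, π y′)).  For the geometry of record (sites = index bonds read at their carrier blocks,
[4] p. 248 *"sites replaced by bonds"*) `π` sends a bond to THE representative bond of its carrier block; `π = id` is `KerReadsLe`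
(`kerReadsLeVia_id_iff`).  A READING HYPOTHESIS here; a theorem at def-Y's letters (`B9Thm39ReadingAtLetters`).
[cite: Balaban1985BackgroundPropagators, Thm 3.2 (3.48) p.398 + (3.96) p.411; Balaban1984PropagatorsII, p.248 + (2.51) p.232] -/
def KerReadsLeVia (𝔬 : Ops39Blk g B X ι κ) (Cv : B9.SiteKernel g B) (d : ℕ) (cR : ℝ) (π : g.Site → g.Site) : Prop :=
  ∀ (U : B.Cfg) (T : Module.End ℝ (X → ℝ)), T * 𝔬.L U = 1 → 𝔬.L U * T = 1 →
    ∀ y y' : g.Site, |Cv.ker U y y'| ≤ cR * (vol g d y')⁻¹ * blockKer 𝔬.blk T (π y) (π y')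

/-- The reading through `π = id` IS the landed reading `KerReadsLe` (by `Iff.rfl`). [cite: Balaban1985BackgroundPropagators, Thm 3.2 (3.48) p.398, bookkeeping] -/
theorem kerReadsLeVia_id_iff (𝔬 : Ops39Blk g B X ι κ) (Cv : B9.SiteKernel g B) (d : ℕ) (cR : ℝ) :
    KerReadsLeVia 𝔬 Cv d cR id ↔ KerReadsLe 𝔬 Cv d cR :=
  Iff.rfl

end OneMember

/-! ## §2 «This theorem implies Theorem 3.2» with the reading through `π` -/

section FamilyKernelSum

variable {I : Type} {c35 : ℝ} {geo : I → B9.Geometry} {bg : I → B9.Backgrounds}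
variable [∀ i, Fintype (geo i).Site] [∀ i, DecidableEq (geo i).Site]
variable {X ι κ : I → Type} [∀ i, Fintype (ι i)] [∀ i, Fintype (X i)] [∀ i, DecidableEq (X i)]

omit [∀ i, Fintype (ι i)] in
/-- **«THIS THEOREM IMPLIES THEOREM 3.2» with the reading through representatives**: for ANY expansion data `E` whose convergence predicate implies
`Conv348Blk (𝔬 i) B₁ δ₁` (B₁ ≧ 0, δ₁ > 0) and any carrier kernel read through `π` (`KerReadsLeVia … cR (π i)`, cR ≧ 0) with `π`-INVARIANT lengths and
distances ([4] p. 231: *"d(x, x′) = d(y, y′) if x ∈ B^j(y), x′ ∈ B^{j′}(y′)"* — the representative of a block has the block's scale and position):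
`B9.RWKernelSumYields d geo bg E Cinv` with the constant max(cR·B₁, 1) — the inverse's (2.51)-majorant at (π y, π y′) is the printed bound at (y, y′).
[cite: Balaban1985BackgroundPropagators, Thm 3.9 ⇒ Thm 3.2 p.413 + (3.48) p.398; Balaban1984PropagatorsII, (2.45)–(2.46) p.231] -/
theorem rwKernelSumYields_of_conv348BlkVia {E : ∀ i, B9.RWKernelExpansion (geo i) (bg i)}
    (𝔬 : ∀ i, Ops39Blk (geo i) (bg i) (X i) (ι i) (κ i)) (Cinv : ∀ i, B9.SiteKernel (geo i) (bg i)) (d : ℕ) {B₁ δ₁ cR : ℝ}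
    (π : ∀ i, (geo i).Site → (geo i).Site)
    (hB₁ : 0 ≤ B₁) (hδ₁ : 0 < δ₁) (hcR : 0 ≤ cR) (hlen : ∀ (i : I) (y : (geo i).Site), 0 < (geo i).len y)
    (hπlen : ∀ (i : I) (y : (geo i).Site), (geo i).len (π i y) = (geo i).len y)
    (hπdist : ∀ (i : I) (y y' : (geo i).Site), (geo i).dist (π i y) (π i y') = (geo i).dist y y')
    (hE : ∀ (i : I) (U : (bg i).Cfg), (E i).Converges U → Conv348Blk (𝔬 i) B₁ δ₁ U)
    (hrd : ∀ i, KerReadsLeVia (𝔬 i) (Cinv i) d cR (π i)) : B9.RWKernelSumYields d geo bg E Cinv := by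
  refine ⟨max (cR * B₁) 1, δ₁, lt_max_of_lt_right one_pos, hδ₁, fun i U hconv y y' => ?_⟩
  obtain ⟨T, hTL, hLT, hmaj⟩ := hE i U hconv
  have hvol := vol_pos d (hlen i)
  have hK : 0 ≤ B₁ * (geo i).len (π i y) ^ (-(4 : ℝ)) * Real.exp (-(δ₁ * (geo i).dist (π i y) (π i y'))) :=
    mul_nonneg (mul_nonneg hB₁ (Real.rpow_nonneg (hlen i _).le _)) (Real.exp_nonneg _)
  have hbk := blockKer_le_of_hasMajorant (𝔬 i).blk hmaj (y := π i y) (y' := π i y') hK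
  rw [hπlen, hπdist] at hbk
  have hrest : 0 ≤ (geo i).len y ^ (-(4 : ℝ)) * (geo i).len y' ^ (-(d : ℝ)) * Real.exp (-(δ₁ * (geo i).dist y y')) :=
    mul_nonneg (mul_nonneg (Real.rpow_nonneg (hlen i y).le _) (Real.rpow_nonneg (hlen i y').le _)) (Real.exp_nonneg _)
  calc |(Cinv i).ker U y y'| ≤ cR * (vol (geo i) d y')⁻¹ * blockKer (𝔬 i).blk T (π i y) (π i y') := hrd i U T hTL hLT y y'
    _ ≤ cR * (vol (geo i) d y')⁻¹ * (B₁ * (geo i).len y ^ (-(4 : ℝ)) * Real.exp (-(δ₁ * (geo i).dist y y'))) :=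
        mul_le_mul_of_nonneg_left hbk (mul_nonneg hcR (inv_nonneg.mpr (hvol y').le))
    _ = cR * B₁ * ((geo i).len y ^ (-(4 : ℝ)) * (geo i).len y' ^ (-(d : ℝ)) * Real.exp (-(δ₁ * (geo i).dist y y'))) := by
        rw [vol_inv d (hlen i) y']
        ring
    _ ≤ max (cR * B₁) 1 * ((geo i).len y ^ (-(4 : ℝ)) * (geo i).len y' ^ (-(d : ℝ)) * Real.exp (-(δ₁ * (geo i).dist y y'))) :=
        mul_le_mul_of_nonneg_right (le_max_left _ _) hrest
    _ = _ := by ring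

omit [∀ i, Fintype (ι i)] in
/-- ★ **`hksum` AT THE PINNED CARRIER DATUM, reading through representatives**: `B9.RWKernelSumYields d geo bg (fun i => EK39OfOpsBlk (𝔬 i) (rd i) d B₁ δ₁) Cinv`
for every carrier kernel read through a `len`∕`dist`-preserving `π` (`KerReadsLeVia`), B₁ ≧ 0, δ₁ > 0, cR ≧ 0, L^jη > 0.
[cite: Balaban1985BackgroundPropagators, Thm 3.9 ⇒ Thm 3.2 p.413 + (3.48) p.398] -/
theorem rwKernelSumYields_EK39OfOpsBlkVia (𝔬 : ∀ i, Ops39Blk (geo i) (bg i) (X i) (ι i) (κ i))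
    (rd : ∀ i, WalkReading39 (bg i) (ι i) (κ i)) (Cinv : ∀ i, B9.SiteKernel (geo i) (bg i)) (d : ℕ) {B₁ δ₁ cR : ℝ}
    (π : ∀ i, (geo i).Site → (geo i).Site)
    (hB₁ : 0 ≤ B₁) (hδ₁ : 0 < δ₁) (hcR : 0 ≤ cR) (hlen : ∀ (i : I) (y : (geo i).Site), 0 < (geo i).len y)
    (hπlen : ∀ (i : I) (y : (geo i).Site), (geo i).len (π i y) = (geo i).len y)
    (hπdist : ∀ (i : I) (y y' : (geo i).Site), (geo i).dist (π i y) (π i y') = (geo i).dist y y')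
    (hrd : ∀ i, KerReadsLeVia (𝔬 i) (Cinv i) d cR (π i)) :
    B9.RWKernelSumYields d geo bg (fun i => EK39OfOpsBlk (𝔬 i) (rd i) d B₁ δ₁) Cinv :=
  rwKernelSumYields_of_conv348BlkVia 𝔬 Cinv d π hB₁ hδ₁ hcR hlen hπlen hπdist (fun _ _ h => h) hrd

omit [∀ i, Fintype (ι i)] in
/-- **THEOREM 3.2 AS TYPED from the two leaves at the carrier datum, reading through representatives** (p. 413: *"This theorem implies Theorem 3.2"*,
the cell's `B9.thm32_of_thm39`). [cite: Balaban1985BackgroundPropagators, Thm 3.9 ⇒ Thm 3.2 p.413 + Thm 3.2 (3.48) p.398] -/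
theorem thm32Printed_EK39OfOpsBlkVia (𝔬 : ∀ i, Ops39Blk (geo i) (bg i) (X i) (ι i) (κ i))
    (rd : ∀ i, WalkReading39 (bg i) (ι i) (κ i)) (Cinv : ∀ i, B9.SiteKernel (geo i) (bg i)) (d : ℕ) {B₁ δ₁ cR : ℝ}
    (π : ∀ i, (geo i).Site → (geo i).Site)
    (hB₁ : 0 ≤ B₁) (hδ₁ : 0 < δ₁) (hcR : 0 ≤ cR) (hlen : ∀ (i : I) (y : (geo i).Site), 0 < (geo i).len y)
    (hπlen : ∀ (i : I) (y : (geo i).Site), (geo i).len (π i y) = (geo i).len y)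
    (hπdist : ∀ (i : I) (y y' : (geo i).Site), (geo i).dist (π i y) (π i y') = (geo i).dist y y')
    (hrd : ∀ i, KerReadsLeVia (𝔬 i) (Cinv i) d cR (π i))
    (h39 : B9.Thm39Printed d c35 geo bg (fun i => EK39OfOpsBlk (𝔬 i) (rd i) d B₁ δ₁)) :
    B9.Thm32Printed d c35 geo bg Cinv :=
  B9.thm32_of_thm39 d c35 geo bg _ Cinv h39 (rwKernelSumYields_EK39OfOpsBlkVia 𝔬 rd Cinv d π hB₁ hδ₁ hcR hlen hπlen hπdist hrd)

end FamilyKernelSum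

/-! ## §3 Rows 15–16 over the carrier at the DEFINITE (2.61) constant, reading through representatives -/

section Rows1516

variable {I : Type} {c35 : ℝ} {geo : I → B9.Geometry} {bg : I → B9.Backgrounds}
variable [∀ i, Fintype (geo i).Site] [∀ i, DecidableEq (geo i).Site]
variable {X ι κ : I → Type} [∀ i, Fintype (ι i)] [∀ i, Fintype (X i)] [∀ i, DecidableEq (X i)]

/-- ★★ **ROWS 15 AND 16 OVER THE CARRIER AT THE DEFINITE DATUM FROM `RowSum261`, reading through representatives**: Theorem 3.9 as the whole
printed leaf AND the kernel-summation leaf at the SAME datum `EK39OfOpsBlk (𝔬 i) (rd i) d (2NB₀·rowConst261 geo (α′r)) ((1 − α′)r)`, for every carrier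
kernel read through a `len`∕`dist`-preserving `π` (`KerReadsLeVia … cR (π i)`, cR ≧ 0); [4] Lemma 2.1 (2.61) supplied by `RowSum261 geo`.  NO existential,
NO (2.61) hypothesis. [cite: Balaban1985BackgroundPropagators, Thm 3.9 p.413 («This theorem implies Theorem 3.2») + Thm 3.2 (3.48) p.398; Balaban1984PropagatorsII, Lemma 2.1 (2.61) p.234] -/
theorem thm39_and_kernelSum_rowConst261BlkVia_of_rowSum261 (𝔬 : ∀ i, Ops39Blk (geo i) (bg i) (X i) (ι i) (κ i))
    (rd : ∀ i, WalkReading39 (bg i) (ι i) (κ i)) (Cinv : ∀ i, B9.SiteKernel (geo i) (bg i)) (d : ℕ)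
    (π : ∀ i, (geo i).Site → (geo i).Site) (α α' r δ₀ θ₀ B₀ N a₁ M₁ cR : ℝ)
    (h35 : 0 < c35) (hα : 0 < α) (hα1 : α < 1) (hα'0 : 0 < α') (hα'1 : α' < 1) (hr : 0 < r) (hrδ : r ≤ δ₀)
    (hθ₀ : 0 ≤ θ₀) (hB₀ : 0 < B₀) (hN : 0 ≤ N) (ha₁ : 0 < a₁) (hM₁ : 0 < M₁) (hcR : 0 ≤ cR)
    (hst : ∀ i, StaticOK39Blk (𝔬 i) N) (hloc : ∀ i, Locality39Blk (𝔬 i) (rd i)) (hrow : B9Ineq349Whole.RowSum261 geo)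
    (hπlen : ∀ (i : I) (y : (geo i).Site), (geo i).len (π i y) = (geo i).len y)
    (hπdist : ∀ (i : I) (y y' : (geo i).Site), (geo i).dist (π i y) (π i y') = (geo i).dist y y')
    (hrd : ∀ i, KerReadsLeVia (𝔬 i) (Cinv i) d cR (π i))
    (h39 : ∀ i, M₁ ≤ (geo i).M → ∀ α₀ : ℝ, 0 < α₀ → c35 * (geo i).M * α₀ ≤ a₁ →
      ∀ U : (bg i).Cfg, (bg i).Reg335 c35 α₀ U →
        Local348Blk (𝔬 i) B₀ δ₀ U ∧ Identities395Blk (𝔬 i) U ∧ Small285Blk (𝔬 i) θ₀ r U ∧ Factors389Blk (𝔬 i) θ₀ δ₀ U) :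
    B9.Thm39Printed d c35 geo bg
        (fun i => EK39OfOpsBlk (𝔬 i) (rd i) d (2 * (N * B₀) * B9RowSum261DefiniteFaces.rowConst261 geo (α' * r))
          ((1 - α') * r)) ∧
      B9.RWKernelSumYields d geo bg
        (fun i => EK39OfOpsBlk (𝔬 i) (rd i) d (2 * (N * B₀) * B9RowSum261DefiniteFaces.rowConst261 geo (α' * r))
          ((1 - α') * r)) Cinv := by
  have hδ₁ : 0 < (1 - α') * r := mul_pos (by linarith) hr
  have hB₁ : 0 ≤ 2 * (N * B₀) * B9RowSum261DefiniteFaces.rowConst261 geo (α' * r) :=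
    mul_nonneg (mul_nonneg zero_le_two (mul_nonneg hN hB₀.le)) (B9RowSum261DefiniteFaces.rowConst261_nonneg geo _)
  exact ⟨thm39Printed_rowConst261Blk_of_rowSum261 𝔬 rd d α α' r δ₀ θ₀ B₀ N a₁ M₁ h35 hα hα1 hα'0 hα'1.le hr hrδ hθ₀ hB₀
      hN ha₁ hM₁ hst hloc hrow h39,
    rwKernelSumYields_EK39OfOpsBlkVia 𝔬 rd Cinv d π hB₁ hδ₁ hcR (fun i y => (hst i).lenpos y) hπlen hπdist hrd⟩

/-- **PIN FORM**: for expansion data `EK i` EQUAL to the definite carrier datum (the knit's literal pin), rows 15 ∧ 16 about `EK`, the reading through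
representatives. [cite: Balaban1985BackgroundPropagators, Thm 3.9 (3.98)–(3.99) p.413 + Thm 3.2 (3.48) p.398] -/
theorem thm39_and_kernelSum_of_pin_rowConst261BlkVia (𝔬 : ∀ i, Ops39Blk (geo i) (bg i) (X i) (ι i) (κ i))
    (rd : ∀ i, WalkReading39 (bg i) (ι i) (κ i)) (Cinv : ∀ i, B9.SiteKernel (geo i) (bg i)) (d : ℕ)
    (π : ∀ i, (geo i).Site → (geo i).Site) (α α' r δ₀ θ₀ B₀ N a₁ M₁ cR : ℝ)
    (h35 : 0 < c35) (hα : 0 < α) (hα1 : α < 1) (hα'0 : 0 < α') (hα'1 : α' < 1) (hr : 0 < r) (hrδ : r ≤ δ₀)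
    (hθ₀ : 0 ≤ θ₀) (hB₀ : 0 < B₀) (hN : 0 ≤ N) (ha₁ : 0 < a₁) (hM₁ : 0 < M₁) (hcR : 0 ≤ cR)
    (hst : ∀ i, StaticOK39Blk (𝔬 i) N) (hloc : ∀ i, Locality39Blk (𝔬 i) (rd i)) (hrow : B9Ineq349Whole.RowSum261 geo)
    (hπlen : ∀ (i : I) (y : (geo i).Site), (geo i).len (π i y) = (geo i).len y)
    (hπdist : ∀ (i : I) (y y' : (geo i).Site), (geo i).dist (π i y) (π i y') = (geo i).dist y y')
    (hrd : ∀ i, KerReadsLeVia (𝔬 i) (Cinv i) d cR (π i))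
    (h39 : ∀ i, M₁ ≤ (geo i).M → ∀ α₀ : ℝ, 0 < α₀ → c35 * (geo i).M * α₀ ≤ a₁ →
      ∀ U : (bg i).Cfg, (bg i).Reg335 c35 α₀ U →
        Local348Blk (𝔬 i) B₀ δ₀ U ∧ Identities395Blk (𝔬 i) U ∧ Small285Blk (𝔬 i) θ₀ r U ∧ Factors389Blk (𝔬 i) θ₀ δ₀ U)
    {EK : ∀ i, B9.RWKernelExpansion (geo i) (bg i)}
    (hEK : ∀ i, EK i = EK39OfOpsBlk (𝔬 i) (rd i) d (2 * (N * B₀) * B9RowSum261DefiniteFaces.rowConst261 geo (α' * r))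
      ((1 - α') * r)) :
    B9.Thm39Printed d c35 geo bg EK ∧ B9.RWKernelSumYields d geo bg EK Cinv := by
  obtain rfl : EK = fun i => EK39OfOpsBlk (𝔬 i) (rd i) d (2 * (N * B₀) * B9RowSum261DefiniteFaces.rowConst261 geo (α' * r))
      ((1 - α') * r) := funext hEK
  exact thm39_and_kernelSum_rowConst261BlkVia_of_rowSum261 𝔬 rd Cinv d π α α' r δ₀ θ₀ B₀ N a₁ M₁ cR h35 hα hα1 hα'0 hα'1 hr
    hrδ hθ₀ hB₀ hN ha₁ hM₁ hcR hst hloc hrow hπlen hπdist hrd h39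

/-- **THEOREM 3.2 AS TYPED at the pinned definite carrier datum, reading through representatives** (p. 413: *"This theorem implies Theorem 3.2"*).
[cite: Balaban1985BackgroundPropagators, Thm 3.9 ⇒ Thm 3.2 p.413 + Thm 3.2 (3.48) p.398] -/
theorem thm32Printed_of_pin_rowConst261BlkVia (𝔬 : ∀ i, Ops39Blk (geo i) (bg i) (X i) (ι i) (κ i))
    (rd : ∀ i, WalkReading39 (bg i) (ι i) (κ i)) (Cinv : ∀ i, B9.SiteKernel (geo i) (bg i)) (d : ℕ)
    (π : ∀ i, (geo i).Site → (geo i).Site) (α α' r δ₀ θ₀ B₀ N a₁ M₁ cR : ℝ)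
    (h35 : 0 < c35) (hα : 0 < α) (hα1 : α < 1) (hα'0 : 0 < α') (hα'1 : α' < 1) (hr : 0 < r) (hrδ : r ≤ δ₀)
    (hθ₀ : 0 ≤ θ₀) (hB₀ : 0 < B₀) (hN : 0 ≤ N) (ha₁ : 0 < a₁) (hM₁ : 0 < M₁) (hcR : 0 ≤ cR)
    (hst : ∀ i, StaticOK39Blk (𝔬 i) N) (hloc : ∀ i, Locality39Blk (𝔬 i) (rd i)) (hrow : B9Ineq349Whole.RowSum261 geo)
    (hπlen : ∀ (i : I) (y : (geo i).Site), (geo i).len (π i y) = (geo i).len y)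
    (hπdist : ∀ (i : I) (y y' : (geo i).Site), (geo i).dist (π i y) (π i y') = (geo i).dist y y')
    (hrd : ∀ i, KerReadsLeVia (𝔬 i) (Cinv i) d cR (π i))
    (h39 : ∀ i, M₁ ≤ (geo i).M → ∀ α₀ : ℝ, 0 < α₀ → c35 * (geo i).M * α₀ ≤ a₁ →
      ∀ U : (bg i).Cfg, (bg i).Reg335 c35 α₀ U →
        Local348Blk (𝔬 i) B₀ δ₀ U ∧ Identities395Blk (𝔬 i) U ∧ Small285Blk (𝔬 i) θ₀ r U ∧ Factors389Blk (𝔬 i) θ₀ δ₀ U)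
    {EK : ∀ i, B9.RWKernelExpansion (geo i) (bg i)}
    (hEK : ∀ i, EK i = EK39OfOpsBlk (𝔬 i) (rd i) d (2 * (N * B₀) * B9RowSum261DefiniteFaces.rowConst261 geo (α' * r))
      ((1 - α') * r)) :
    B9.Thm32Printed d c35 geo bg Cinv := by
  obtain ⟨h39P, hks⟩ := thm39_and_kernelSum_of_pin_rowConst261BlkVia 𝔬 rd Cinv d π α α' r δ₀ θ₀ B₀ N a₁ M₁ cR h35 hα hα1
    hα'0 hα'1 hr hrδ hθ₀ hB₀ hN ha₁ hM₁ hcR hst hloc hrow hπlen hπdist hrd h39 hEK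
  exact B9.thm32_of_thm39 d c35 geo bg _ Cinv h39P hks

end Rows1516

/-! ## §4 At def-Y's operator-layer signature over the members of record -/

section StageY

open B9PinMembersKLevelV1 B9PinCarriersKLevelV1 B9GeoLemma21KLevelV1

variable {d ℓ : ℕ} {hd : 1 ≤ d + 1} {hL : Odd (ℓ + 1) ∧ 1 < ℓ + 1} {b₀ b₁ : ℝ} {Mstar : ℕ}
variable {𝔸 : Type} [NormedRing 𝔸] [NormedAlgebra ℂ 𝔸] [CompleteSpace 𝔸] {G : Subgroup 𝔸ˣ}
variable (ops : ∀ x : MemberY d ℓ hd hL b₀ b₁ Mstar, OperatorLayerY d ℓ hd hL b₀ b₁ Mstar 𝔸 G x)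
variable [∀ x : MemberY d ℓ hd hL b₀ b₁ Mstar, Fintype (geo9Y x).Site]
  [∀ x : MemberY d ℓ hd hL b₀ b₁ Mstar, DecidableEq (geo9Y x).Site]
variable {c35 : ℝ} {X39 ι κ : MemberY d ℓ hd hL b₀ b₁ Mstar → Type} [∀ x, Fintype (ι x)] [∀ x, Fintype (X39 x)]
  [∀ x, DecidableEq (X39 x)]

/-- ★ **ROWS 15 ∧ 16 OF THE N06 KNIT FROM THE LITERAL CARRIER PIN AT THE DEFINITE CONSTANT, THE READING THROUGH REPRESENTATIVES** (the `π`-twin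
of `B9Thm39WholeBlkFaces.t39_hksum_of_pin_rowConst261Blk`): over def-Y's operator layer `ops`, for Theorem-3.9 carrier letters `𝔬39 x : Ops39Blk
(geo9Y x) (bg9Y 𝔸 G x) (X39 x) (ι x) (κ x)` read by `rd39`, the pin `(ops x).EK39 = EK39OfOpsBlk (𝔬39 x) (rd39 x) dd (2(N·B₀)·rowConst261 geo9Y (α′r))
((1−α′)r)`, a representative map `π x` of the member's sites preserving `len` and `dist` (at the record: ONE index bond per carrier block, [4] p. 248
*"sites replaced by bonds"*), and a carrier kernel `(ops x).Cinv` read through it (`KerReadsLeVia … cR (π x)`): `B9.Thm39Printed dd c35 geo9Y (bg9Y 𝔸 G)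
(fun x => (ops x).EK39)` ∧ `B9.RWKernelSumYields dd geo9Y (bg9Y 𝔸 G) (fun x => (ops x).EK39) (fun x => (ops x).Cinv)`; [4] (2.61) at both rates is
n06-i's `rowSum261_geo9Y` BY NAME. [cite: Balaban1985BackgroundPropagators, Thm 3.9 (3.98)–(3.99) p.413 + Thm 3.2 (3.48) p.398; Balaban1984PropagatorsII, Lemma 2.1 (2.61) p.234 + p.248] -/
theorem t39_hksum_of_pin_rowConst261BlkVia
    (𝔬39 : ∀ x : MemberY d ℓ hd hL b₀ b₁ Mstar, Ops39Blk (geo9Y x) (bg9Y 𝔸 G x) (X39 x) (ι x) (κ x))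
    (rd39 : ∀ x : MemberY d ℓ hd hL b₀ b₁ Mstar, WalkReading39 (bg9Y 𝔸 G x) (ι x) (κ x))
    (π : ∀ x : MemberY d ℓ hd hL b₀ b₁ Mstar, (geo9Y x).Site → (geo9Y x).Site)
    (dd : ℕ) (α α' r δ₀ θ₀ B₀ N a₁ M₁ cR : ℝ)
    (h35 : 0 < c35) (hα : 0 < α) (hα1 : α < 1) (hα'0 : 0 < α') (hα'1 : α' < 1) (hr : 0 < r) (hrδ : r ≤ δ₀)
    (hθ₀ : 0 ≤ θ₀) (hB₀ : 0 < B₀) (hN : 0 ≤ N) (ha₁ : 0 < a₁) (hM₁ : 0 < M₁) (hcR : 0 ≤ cR)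
    (hst : ∀ x, StaticOK39Blk (𝔬39 x) N) (hloc : ∀ x, Locality39Blk (𝔬39 x) (rd39 x))
    (hπlen : ∀ (x : MemberY d ℓ hd hL b₀ b₁ Mstar) (y : (geo9Y x).Site), (geo9Y x).len (π x y) = (geo9Y x).len y)
    (hπdist : ∀ (x : MemberY d ℓ hd hL b₀ b₁ Mstar) (y y' : (geo9Y x).Site), (geo9Y x).dist (π x y) (π x y') = (geo9Y x).dist y y')
    (h39 : ∀ x : MemberY d ℓ hd hL b₀ b₁ Mstar, M₁ ≤ (geo9Y x).M → ∀ α₀ : ℝ, 0 < α₀ → c35 * (geo9Y x).M * α₀ ≤ a₁ →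
      ∀ U : (bg9Y 𝔸 G x).Cfg, (bg9Y 𝔸 G x).Reg335 c35 α₀ U →
        Local348Blk (𝔬39 x) B₀ δ₀ U ∧ Identities395Blk (𝔬39 x) U ∧ Small285Blk (𝔬39 x) θ₀ r U ∧
          Factors389Blk (𝔬39 x) θ₀ δ₀ U)
    (hEK39 : ∀ x : MemberY d ℓ hd hL b₀ b₁ Mstar, (ops x).EK39 =
      EK39OfOpsBlk (𝔬39 x) (rd39 x) dd
        (2 * (N * B₀) * B9RowSum261DefiniteFaces.rowConst261
          (geo9Y (d := d) (ℓ := ℓ) (hd := hd) (hL := hL) (b₀ := b₀) (b₁ := b₁) (Mstar := Mstar)) (α' * r)) ((1 - α') * r))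
    (hrdC : ∀ x : MemberY d ℓ hd hL b₀ b₁ Mstar, KerReadsLeVia (𝔬39 x) (ops x).Cinv dd cR (π x)) :
    B9.Thm39Printed dd c35 geo9Y (bg9Y 𝔸 G) (fun x => (ops x).EK39) ∧
      B9.RWKernelSumYields dd geo9Y (bg9Y 𝔸 G) (fun x => (ops x).EK39) (fun x => (ops x).Cinv) :=
  thm39_and_kernelSum_of_pin_rowConst261BlkVia 𝔬39 rd39 (fun x => (ops x).Cinv) dd π α α' r δ₀ θ₀ B₀ N a₁ M₁ cR h35 hα hα1 hα'0
    hα'1 hr hrδ hθ₀ hB₀ hN ha₁ hM₁ hcR hst hloc rowSum261_geo9Y hπlen hπdist hrdC h39 hEK39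

end StageY

end

end Literature.MathematicalPhysics.QuantumFieldTheory.Balaban1983to89.B9Thm39WholeBlkVia
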